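import Mathlib
import Summits.ValiantsHypothesis.ValiantsHypothesis.Theorems.GrenetZeonPolySizeQPAlgebraCurvilinearBound
import Summits.ValiantsHypothesis.ValiantsHypothesis.Theorems.GrenetZeonPolySizeQPAlgebraCubeZeroIntrinsic
import Summits.ValiantsHypothesis.ValiantsHypothesis.Theorems.GrenetZeonPolySizeQPAlgebraSquareZeroResidue
import Summits.ValiantsHypothesis.ValiantsHypothesis.Theorems.GrenetZeonPolySizeQPAlgebraLocalReductionDim
import HarnessLib

/-!
# Crux `GrenetZeon.PolySizeQPAlgebra` (stmt-ValiantsHypothesis-8064), line `vbp-slice-dealg` —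
# input (B) for every local piece of dimension `≤ 4`, and the rung `(n, ≤ 4)` BY NAME from ONE good `5`-space

The `c = 1` box of the piece at the degree floor `m = n` reduces (`…LocalReductionDim`) to two named inputs:
(B) the type-independent local Hessian bound `rank Hess λ(det A)(p) ≤ 2·dim R·n` for the local Frobenius
pieces `R` of dimension `≤ s`, and (A) a good `(s+1)`-space with threshold `2sn`.  The hand chain proved (B)
type by type: curvilinear algebras (`…JetHessian`, in coefficient-algebra currency `…CurvilinearBound`),
square-zero algebras (`…SquareZeroResidue`), and algebras with `𝔪³ = 0` (`…CubeZeroIntrinsic`, large `n`).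
This file PACKAGES them for `s = 4`:

* `ker_pow_three_eq_bot_of_cube_zero` — if every element of `ker φ` has vanishing cube then `(ker φ)³ = 0`
  (polarisation `6abc = (a+b+c)³ - (a+b)³ - (a+c)³ - (b+c)³ + a³ + b³ + c³`, characteristic `0`).
* `exists_basis_pow_or_cube_zero_of_finrank_le_four` — **classification:** a local Frobenius `ℂ`-algebra
  (character `φ` with nilpotent kernel, nondegenerate functional) of dimension `≤ 4` is either CURVILINEAR
  (basis `1, e, …, e^{r-1}`, `e^r = 0`) or has dimension `4` and `(ker φ)³ = 0`
  (`exists_basis_pow_of_finrank_le_three`, `exists_basis_pow_four_of_cube_ne_zero`).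
* `localHessianBound_of_finrank_le_four` — **input (B) is a THEOREM for every local Frobenius piece of
  dimension `≤ 4` and every `n ≥ 6`:** `det A(p) = 0` in `R` ⟹ `rank Hess λ(det A)(p) ≤ 2·dim R·n`
  (curvilinear: `rank_hess0_transl_le_of_basis_pow`, any `n`; square-zero:
  `rank_hess0_transl_le_of_sqZero_algebra_of_two_le_finrank`, any `n`; otherwise `dim R = 4`, `𝔪³ = 0`,
  `𝔪² ≠ 0`, so `dim R/𝔪² ≤ 3` and `rank_hess0_transl_le_of_cube_zero'` applies once `27 ≤ 2n + 16`, i.e.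
  `n ≥ 6`).
* `not_hasAlgDetRepr_perPoly_le_four_of_goodFiveSpace` — **the rung `(n, ≤ 4)` BY NAME: if five linearly
  independent `n × n` matrices span a space on which every non-zero zero of `per_n` has
  `rank Hess per_n > 8n` (`n ≥ 6`), then `¬ HasAlgDetRepr per_n m s` for all `m ≤ n`, `s ≤ 4`** — the
  residual type `ℂ[x,y]/(x²,y²)` left open by `…CornerFour` / `…CornerFourGlue` is now excluded too
  (`not_hasAlgDetRepr_perPoly_self_of_localHessianBound_dim` with `s = 4`, `c = 5`, `t = 8n`);
  `…_of_goodSpace` — any good `c`-space, `c ≥ 5`, threshold `≥ 8n`;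
  `corner_four_all_large_of_goodFiveSpaces` — the all-large-`n` column form.

So for the rungs `(n, ≤ 4)` of the `c = 1` box input (B) is DISCHARGED; what remains is input (A) alone
(one good `5`-space with threshold `8n` for all large `n`; design evidence in the hand memos: bordered
`5 × 5` circulant cores).  HONEST FRAMING: packaging of conditional reductions and rank theorems; no stub
of the line (`stub_vbpSlice`, `stub_dealgebraizePoly`) is closed; VP ≠ VNP is not moved.

References: T. Mignon, N. Ressayre, IMRN 2004:79, §2 [MignonRessayre2004].
-/

noncomputable section

open MvPolynomial Matrix
open Literature.Computability.AlgebraicComplexity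

-- single-conjunct layout `Summits/ValiantsHypothesis/ValiantsHypothesis`: duplicated namespace by design
set_option linter.dupNamespace false

namespace Summit.ValiantsHypothesis.ValiantsHypothesis.Theorems.GrenetZeonPolySizeQPAlgebra

/-! ### Cube-zero kernels and the classification in dimension `≤ 4` -/

section Classify

variable {R : Type*} [CommRing R] [Algebra ℂ R]

/-- **A kernel all of whose elements have vanishing cube is nilpotent of index `3`.**  Polarisation in
characteristic `0`: `6abc = (a+b+c)³ - (a+b)³ - (a+c)³ - (b+c)³ + a³ + b³ + c³`. [folklore] -/
theorem ker_pow_three_eq_bot_of_cube_zero (φ : R →ₐ[ℂ] ℂ) (hcube : ∀ e : R, φ e = 0 → e ^ 3 = 0) :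
    RingHom.ker (φ : R →+* ℂ) ^ 3 = ⊥ := by
  have hφ : ∀ x ∈ RingHom.ker (φ : R →+* ℂ), x ^ 3 = 0 := fun x hx => hcube x (by simpa using hx)
  have h3 : ∀ a ∈ RingHom.ker (φ : R →+* ℂ), ∀ b ∈ RingHom.ker (φ : R →+* ℂ),
      ∀ c ∈ RingHom.ker (φ : R →+* ℂ), a * b * c = 0 := by
    intro a ha b hb c hc
    have h6 : (6 : R) * (a * b * c) =
        (a + b + c) ^ 3 - (a + b) ^ 3 - (a + c) ^ 3 - (b + c) ^ 3 + a ^ 3 + b ^ 3 + c ^ 3 := by ring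
    rw [hφ _ (add_mem (add_mem ha hb) hc), hφ _ (add_mem ha hb), hφ _ (add_mem ha hc),
      hφ _ (add_mem hb hc), hφ a ha, hφ b hb, hφ c hc] at h6
    simp only [sub_zero, add_zero] at h6
    have h6' : (6 : ℂ) • (a * b * c) = 0 := by
      rw [Algebra.smul_def, map_ofNat]; exact h6
    calc a * b * c = (6 : ℂ)⁻¹ • ((6 : ℂ) • (a * b * c)) := by
          rw [smul_smul, inv_mul_cancel₀ (by norm_num : (6 : ℂ) ≠ 0), one_smul]
      _ = 0 := by rw [h6', smul_zero]
  rw [show (3 : ℕ) = 2 + 1 from rfl, pow_succ, pow_two, eq_bot_iff, Ideal.mul_le]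
  intro r hr s hs
  rw [Ideal.mem_bot]
  refine Submodule.mul_induction_on (C := fun r => r * s = 0) hr (fun a ha b hb => h3 a ha b hb s hs) ?_
  intro x y hx hy
  show (x + y) * s = 0
  rw [add_mul, hx, hy, add_zero]

variable [Module.Finite ℂ R]

/-- **Classification of local Frobenius algebras of dimension `≤ 4`.**  Let `R` carry a character `φ` with
nilpotent kernel and a nondegenerate functional `λ`, `dim_ℂ R ≤ 4`.  Then either `R` is CURVILINEAR — a basis
`(1, e, …, e^{r-1})` with `e^r = 0` — or `dim R = 4` and `(ker φ)³ = 0` (the types `ℂ[x,y]/(x²,y²)` etc.).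
Dimension `≤ 3`: `exists_basis_pow_of_finrank_le_three`; dimension `4` with a non-zero cube in `ker φ`:
`exists_basis_pow_four_of_cube_ne_zero`; otherwise `ker_pow_three_eq_bot_of_cube_zero`. [folklore] -/
theorem exists_basis_pow_or_cube_zero_of_finrank_le_four (φ : R →ₐ[ℂ] ℂ) {s : ℕ}
    (hker : RingHom.ker (φ : R →+* ℂ) ^ s = ⊥) (l : R →ₗ[ℂ] ℂ)
    (hl : ∀ x : R, (∀ y, l (y * x) = 0) → x = 0) (h4 : Module.finrank ℂ R ≤ 4) :
    (∃ (r : ℕ) (e : R), e ^ r = 0 ∧ ∃ b : Module.Basis (Fin r) ℂ R, ∀ j, b j = e ^ (j : ℕ)) ∨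
      (Module.finrank ℂ R = 4 ∧ RingHom.ker (φ : R →+* ℂ) ^ 3 = ⊥) := by
  have hnt : Nontrivial R := ⟨⟨1, 0, fun h10 => one_ne_zero ((map_one φ).symm.trans
    (by rw [h10, map_zero]))⟩⟩
  have h1 : 1 ≤ Module.finrank ℂ R := Module.finrank_pos
  by_cases h3 : Module.finrank ℂ R ≤ 3
  · obtain ⟨e, he, b, hb⟩ := exists_basis_pow_of_finrank_le_three φ hker l hl rfl h1 h3
    exact Or.inl ⟨_, e, he, b, hb⟩
  · have hR4 : Module.finrank ℂ R = 4 := by omega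
    by_cases hc : ∃ e : R, φ e = 0 ∧ e * e * e ≠ 0
    · obtain ⟨e, hφe, he3⟩ := hc
      obtain ⟨he4, b, hb⟩ := exists_basis_pow_four_of_cube_ne_zero φ hker hR4 hφe he3
      exact Or.inl ⟨4, e, he4, b, hb⟩
    · push Not at hc
      refine Or.inr ⟨hR4, ker_pow_three_eq_bot_of_cube_zero φ fun e hφe => ?_⟩
      rw [pow_succ, pow_two]
      exact hc e hφe

end Classify

/-! ### Input (B) for every piece of dimension `≤ 4` -/

section Bound

variable {σ : Type*} [Fintype σ] [DecidableEq σ] {R : Type*} [CommRing R] [Algebra ℂ R]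
  [Module.Finite ℂ R]

/-- **`LocalHessianBound` for every local Frobenius piece of dimension `≤ 4`, `n ≥ 6`.**  For a
finite-dimensional commutative `ℂ`-algebra `R` of dimension `≤ 4` with a character `φ` of nilpotent kernel and a
nondegenerate functional `λ`, every affine `n × n` matrix `A` over `R[x_σ]` with `F = λ(det A)` coefficientwise,
and every point `p` with `det A(p) = 0` in `R`: `rank Hess F(p) ≤ 2 · dim_ℂ R · n`, provided `n ≥ 6`.
Curvilinear types: `rank_hess0_transl_le_of_basis_pow` (any `n`); square-zero:
`rank_hess0_transl_le_of_sqZero_algebra_of_two_le_finrank` (any `n`); the remaining type (`dim R = 4`,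
`𝔪³ = 0 ≠ 𝔪²`, i.e. `ℂ[x,y]/(x²,y²)`): `rank_hess0_transl_le_of_cube_zero'` with `dim R/𝔪² ≤ 3`, threshold
`27 ≤ 2n + 16`. [cite: MignonRessayre2004, §2] -/
theorem localHessianBound_of_finrank_le_four {n : ℕ} (hn : 6 ≤ n) (hR : Module.finrank ℂ R ≤ 4)
    (φ : R →ₐ[ℂ] ℂ) {ν : ℕ} (hker : RingHom.ker (φ : R →+* ℂ) ^ ν = ⊥) (l : R →ₗ[ℂ] ℂ)
    (hl : ∀ r : R, (∀ x, l (x * r) = 0) → r = 0) (A : Matrix (Fin n) (Fin n) (MvPolynomial σ R))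
    (F : MvPolynomial σ ℂ) (hA : ∀ a b, (A a b).totalDegree ≤ 1) (hF : ∀ d, l (coeff d A.det) = coeff d F)
    (p : σ → ℂ) (hp : eval (fun i => algebraMap ℂ R (p i)) A.det = 0) :
    (hess0 (transl p F)).rank ≤ 2 * Module.finrank ℂ R * n := by
  classical
  rcases exists_basis_pow_or_cube_zero_of_finrank_le_four φ hker l hl hR with
    ⟨r, e, he, b, hb⟩ | ⟨hR4, hk3⟩
  · exact rank_hess0_transl_le_of_basis_pow e he b hb l A F hA hF p hp
  · by_cases hsq : ∀ a b : R, φ a = 0 → φ b = 0 → a * b = 0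
    · exact rank_hess0_transl_le_of_sqZero_algebra_of_two_le_finrank φ hsq (by omega) l A F hA hF p hp
    · -- `𝔪² ≠ 0`: a non-zero product of two kernel elements, so `dim 𝔪² ≥ 1` and `dim R/𝔪² ≤ 3`
      push Not at hsq
      obtain ⟨a, c, ha, hc, hac⟩ := hsq
      have hmem : a * c ∈ (RingHom.ker (φ : R →+* ℂ) ^ 2).restrictScalars ℂ := by
        rw [Submodule.restrictScalars_mem, pow_two]
        exact Ideal.mul_mem_mul (by simpa using ha) (by simpa using hc)
      have hpos : 1 ≤ Module.finrank ℂ ((RingHom.ker (φ : R →+* ℂ) ^ 2).restrictScalars ℂ) := by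
        haveI : Nontrivial ((RingHom.ker (φ : R →+* ℂ) ^ 2).restrictScalars ℂ) :=
          ⟨⟨⟨a * c, hmem⟩, 0, fun h => hac (by simpa using congrArg Subtype.val h)⟩⟩
        exact Module.finrank_pos
      refine rank_hess0_transl_le_of_cube_zero' φ hk3 (by omega) ?_ l A F hA hF p hp
      rw [hR4]
      omega

/-- The same for matrices of LINEAR forms (the shape inlined in `…LocalReduction` / `…LocalReductionDim`).
[cite: MignonRessayre2004, §2] -/
theorem localHessianBound_of_finrank_le_four_of_isHomogeneous {n : ℕ} (hn : 6 ≤ n)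
    (hR : Module.finrank ℂ R ≤ 4) (φ : R →ₐ[ℂ] ℂ) {ν : ℕ} (hker : RingHom.ker (φ : R →+* ℂ) ^ ν = ⊥)
    (l : R →ₗ[ℂ] ℂ) (hl : ∀ r : R, (∀ x, l (x * r) = 0) → r = 0)
    (A : Matrix (Fin n) (Fin n) (MvPolynomial σ R)) (F : MvPolynomial σ ℂ)
    (hA : ∀ a b, (A a b).IsHomogeneous 1) (hF : ∀ d, l (coeff d A.det) = coeff d F)
    (p : σ → ℂ) (hp : eval (fun i => algebraMap ℂ R (p i)) A.det = 0) :
    (hess0 (transl p F)).rank ≤ 2 * Module.finrank ℂ R * n :=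
  localHessianBound_of_finrank_le_four hn hR φ hker l hl A F (fun a b => (hA a b).totalDegree_le) hF p hp

end Bound

/-! ### The rung `(n, ≤ 4)` from one good `5`-space -/

section Rung

/-- **The rung `(n, ≤ 4)` BY NAME from ONE good `5`-space with threshold `8n` (`n ≥ 6`).**  If five
linearly independent `n × n` matrices span a space on which every non-zero zero of `per_n` has
`rank Hess per_n > 8n`, then `per_n` has no `(m, s)`-representation with `m ≤ n` and `s ≤ 4`; in particular
`¬ HasAlgDetRepr per_n n 4` — the residual type `ℂ[x,y]/(x²,y²)` of `…CornerFour` included.  Proof: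
`not_hasAlgDetRepr_perPoly_self_of_localHessianBound_dim` (`s = 4`, `c = 5`, `t = 8n`) with input (B) supplied
by `localHessianBound_of_finrank_le_four_of_isHomogeneous`. [cite: MignonRessayre2004, §2] -/
theorem not_hasAlgDetRepr_perPoly_le_four_of_goodFiveSpace {n : ℕ} (hn : 6 ≤ n)
    (hW : ∃ w : Fin 5 → (Fin n × Fin n → ℂ), LinearIndependent ℂ w ∧
      ∀ a : Fin 5 → ℂ, a ≠ 0 → eval (∑ i, a i • w i) (perPoly (Fin n) ℂ) = 0 →
        8 * n < (hess0 (transl (∑ i, a i • w i) (perPoly (Fin n) ℂ))).rank)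
    {m s : ℕ} (hm : m ≤ n) (hs : s ≤ 4) : ¬ HasAlgDetRepr (perPoly (Fin n) ℂ) m s := by
  intro h
  refine not_hasAlgDetRepr_perPoly_self_of_localHessianBound_dim (s := 4) (c := 5) (t := 8 * n)
    (by omega) ?_ hW (by norm_num) (by omega) (h.mono hm hs)
  intro R _ _ _ hR φ ν hker l hl A F hA hF p hp
  exact localHessianBound_of_finrank_le_four_of_isHomogeneous hn hR φ hker l hl A F hA hF p hp

/-- **The rung `(n, ≤ 4)` from any good `c`-space, `c ≥ 5`, threshold `t ≥ 8n` (`n ≥ 6`).**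
[cite: MignonRessayre2004, §2] -/
theorem not_hasAlgDetRepr_perPoly_le_four_of_goodSpace {n c t : ℕ} (hn : 6 ≤ n) (hc : 5 ≤ c)
    (ht : 8 * n ≤ t)
    (hW : ∃ w : Fin c → (Fin n × Fin n → ℂ), LinearIndependent ℂ w ∧
      ∀ a : Fin c → ℂ, a ≠ 0 → eval (∑ i, a i • w i) (perPoly (Fin n) ℂ) = 0 →
        t < (hess0 (transl (∑ i, a i • w i) (perPoly (Fin n) ℂ))).rank)
    {m s : ℕ} (hm : m ≤ n) (hs : s ≤ 4) : ¬ HasAlgDetRepr (perPoly (Fin n) ℂ) m s :=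
  not_hasAlgDetRepr_perPoly_le_four_of_goodFiveSpace hn (goodSpace_mono ht (goodSpace_restrict hc hW)) hm hs

/-- **In particular `¬ HasAlgDetRepr per_n n 4`** from one good `5`-space with threshold `8n`, `n ≥ 6`.
[cite: MignonRessayre2004, §2] -/
theorem not_hasAlgDetRepr_perPoly_self_four_of_goodFiveSpace {n : ℕ} (hn : 6 ≤ n)
    (hW : ∃ w : Fin 5 → (Fin n × Fin n → ℂ), LinearIndependent ℂ w ∧
      ∀ a : Fin 5 → ℂ, a ≠ 0 → eval (∑ i, a i • w i) (perPoly (Fin n) ℂ) = 0 →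
        8 * n < (hess0 (transl (∑ i, a i • w i) (perPoly (Fin n) ℂ))).rank) :
    ¬ HasAlgDetRepr (perPoly (Fin n) ℂ) n 4 :=
  not_hasAlgDetRepr_perPoly_le_four_of_goodFiveSpace hn hW le_rfl le_rfl

/-- **All large `n`:** good `5`-spaces with threshold `8n` for all large `n` empty the corner
`(m, s) ≤ (n, 4)` of the `c = 1` box of the piece for all large `n`
(`corner_all_large_of_localHessianBound_dim_eventually` with `s = 4`, `n₁ = 6`). [folklore] -/
theorem corner_four_all_large_of_goodFiveSpaces
    (hW : ∃ n₀ : ℕ, ∀ n ≥ n₀, ∃ w : Fin 5 → (Fin n × Fin n → ℂ), LinearIndependent ℂ w ∧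
      ∀ a : Fin 5 → ℂ, a ≠ 0 → eval (∑ i, a i • w i) (perPoly (Fin n) ℂ) = 0 →
        8 * n < (hess0 (transl (∑ i, a i • w i) (perPoly (Fin n) ℂ))).rank) :
    ∃ n₀ : ℕ, ∀ n ≥ n₀, ∀ m s : ℕ, m ≤ n → s ≤ 4 → ¬ HasAlgDetRepr (perPoly (Fin n) ℂ) m s := by
  obtain ⟨n₀, h⟩ := hW
  refine ⟨max n₀ 6, fun n hn m s hm hs => ?_⟩
  exact not_hasAlgDetRepr_perPoly_le_four_of_goodFiveSpace (le_of_max_le_right hn)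
    (h n (le_of_max_le_left hn)) hm hs

/-- **All large `n`, any good spaces:** good `c_n`-spaces (`c_n ≥ 5`) with thresholds `t_n ≥ 8n` for all large
`n` empty the corner `(m, s) ≤ (n, 4)` for all large `n` — the unconditional-in-(B) form of
`corner_four_all_large_of_goodSpaces` (`…CornerFourGlue`), whose residual alternative is gone. [folklore] -/
theorem corner_four_all_large_of_goodSpaces'
    (hW : ∃ n₀ : ℕ, ∀ n ≥ n₀, ∃ c t : ℕ, 5 ≤ c ∧ 8 * n ≤ t ∧
      ∃ w : Fin c → (Fin n × Fin n → ℂ), LinearIndependent ℂ w ∧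
        ∀ a : Fin c → ℂ, a ≠ 0 → eval (∑ i, a i • w i) (perPoly (Fin n) ℂ) = 0 →
          t < (hess0 (transl (∑ i, a i • w i) (perPoly (Fin n) ℂ))).rank) :
    ∃ n₀ : ℕ, ∀ n ≥ n₀, ∀ m s : ℕ, m ≤ n → s ≤ 4 → ¬ HasAlgDetRepr (perPoly (Fin n) ℂ) m s := by
  obtain ⟨n₀, h⟩ := hW
  refine ⟨max n₀ 6, fun n hn m s hm hs => ?_⟩
  obtain ⟨c, t, hc, ht, hgood⟩ := h n (le_of_max_le_left hn)
  exact not_hasAlgDetRepr_perPoly_le_four_of_goodSpace (le_of_max_le_right hn) hc ht hgood hm hs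

end Rung

end Summit.ValiantsHypothesis.ValiantsHypothesis.Theorems.GrenetZeonPolySizeQPAlgebra

end
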